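import Literature.Combinatorics.SimpleGraph.WeightedMatrixForestTheorem
import HarnessLib

/-!
# The inverse form of the matrix-forest theorem: `L(R)⁻¹ = (w_{ij}(R ∪ {j}) / w(R))`, the forest
# identities behind the Green and harmonic tree formulas (Pitman–Tang Thm. 1.2, Lemma 2.2, (2.9))

Topic `Literature/Combinatorics/Enumerative`, namespace `Literature.Combinatorics.Enumerative`.
Lane `lit-hodgefound`, seat p23, generation 47, row g47-#1 of the programme «Tree and forest
formulas for finite Markov chains» (J. Pitman, W. Tang, *Tree formulas, mean first passage times and
Kemeny's constant of a Markov chain*, Bernoulli 24 (2018) 1942–1972 [PitmanTang2018]).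

## Source, verbatim ([PitmanTang2018], held text `paper:arxiv-1603.09017`, §1 pp. 3–4, §2 pp. 6–7)

«For a directed graph **g** with vertex set `S`, write `i → j ∈ g` to indicate that `(i,j)` is a
directed edge of **g** and call `Π^P(g) := ∏_{i→j ∈ g} p_{ij}` the **P**-weight of **g**. Each forest
**f** with vertex set `S` and edges directed towards root vertices consists of some number `r` of
trees […]. **Theorem 1.2** (Kirchhoff's matrix forest theorem for directed graphs) [Chaiken, Chen,
Pokarowski]. Let `R` be a subset of the finite state space `S` of a Markov chain `(X_n)` with
transition matrix **P**. Let `L := I − P` […], and let `L(R)` be the matrix indexed by `S ∖ R`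
obtained by removing from `L` all the rows and columns indexed by `R`. Then
`det L(R) = w(R) := Σ_{roots(f) = R} Π^P(f)` (1.4), where the sum is over all forests **f** labeled by
`S` whose set of roots is `R`. Moreover, if `det L(R) > 0`, then
`L(R)⁻¹ = ( w_{ij}(R ∪ {j}) / w(R) )_{i,j ∈ S∖R}` (1.5) where
`w_{ij}(R ∪ {j}) := Σ_{roots(f) = R ∪ {j}, i ⤳ j} Π^P(f)` (1.6) is the **P**-weight of all forests **f**
with roots `R ∪ {j}` in which the tree component containing `i` has root `j`.»
§2, proof of the harmonic tree formula (1.9): «After canceling the common factor of `w(R)` and putting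
all terms involving `w_{ir}` on the left side, the harmonic equation for `w_{ir}(R), i ∈ S ∖ R` becomes
`(Σ_{j ≠ i} p_{ij}) w_{ir}(R) = Σ_{k ≠ i} p_{ik} w_{kr}(R)`. The equality of these two expressions is
established by matching the terms appearing in the sums on the two sides […] Given `(j, f)` on the
l.h.s., let `i → k` be the edge out of `i` in **f**. Create **f′** by deleting this edge and replacing
it with `i → j`.» **Lemma 2.2.** «For `j ∈ S ∖ R`,
`w(R ∪ {j}) = w(R) + Σ_{k ∈ S∖R} p_{jk} w_{kj}(R ∪ {j})`.» (proof: «for each choice of `(f, t)`, we can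
split the product […]; the sum of first part is evidently `w(R)` […] forests **f′** where the fringe
subtree of **f′** rooted at `j` equals **t** and that subtree is attached to the remaining forest
**f** at vertex `k`».)

## What is here (arbitrary arc weights `a u v` in a commutative ring; no Markov hypothesis)

Forests are recorded as in the tree's `CayleyForests` / `WeightedMatrixForestTheorem` by PARENT MAPS
`τ : V → V` with root set `R` (`IsForestOn univ R τ`: `τ` fixes `R`, every vertex reaches `R` under
iteration; the arcs are `v → τ v`, `v ∉ R`, pointing towards the roots), the weight of a forest being
`∏_{v ∉ R} a v (τ v)`; the tree's Laplacian `wLaplacian a` (`L = D − W`, zero row sums, loops ignored)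
is Pitman–Tang's `L = I − P` when the weights are the rows of a stochastic matrix.

* §1 `Leads τ i j` (`i ⤳ j`: `τ^[n] i = j` for some `n`) and its path calculus inside a rooted forest
  (every vertex leads to exactly one root, `IsForestOn.root_unique`; no return to a non-root,
  `IsForestOn.not_leads_apply_self`; surgery: redirecting one arc, `iterate_update_of_forall_ne`,
  `leads_update_iff_of_not_leads`, `IsForestOn.update_erase`, `IsForestOn.update_of_not_leads`,
  `IsForestOn.update_self_insert`).
* §2 `forestWeight a R = w(R)` and `forestWeightTo a R i j = w_{ij}(R)` (the weight of the forests
  with root set `R` in which `i` leads to `j`); `Σ_{r ∈ R} w_{ir}(R) = w(R)`; the tree's matrix-forest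
  theorem restated: **`det L(R) = w(R)`** (`det_wLaplacian_submatrix_eq_forestWeight`, IMPORTED from
  `WeightedMatrixForestTheorem.det_wLaplacian_submatrix`, i.e. (1.4) for arbitrary weights).
* §3 the two bijective identities, for ARBITRARY weights: **Lemma 2.2** in the division-free form
  `(Σ_{k ≠ j} a_{jk}) · w(R ∪ {j}) = w(R) + Σ_{k ∉ R ∪ {j}} a_{jk} w_{kj}(R ∪ {j})`
  (`outWeight_mul_forestWeight_insert`; the printed form with unit row sums:
  `forestWeight_insert_of_rowsum`), and the **harmonic identity (2.9)**
  `(Σ_{k ≠ i} a_{ik}) · w_{ir}(R) = Σ_{k ≠ i} a_{ik} w_{kr}(R)` for `i ∉ R ∋ r`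
  (`outWeight_mul_forestWeightTo`), proved by the printed arc exchanges on parent maps.
* §4 **Theorem 1.2, second half, cleared of denominators and for arbitrary weights**:
  `L(R) · (w_{ij}(R ∪ {j}))_{i,j ∉ R} = w(R) · I` (`wLaplacian_submatrix_mul_forestWeightTo`), hence
  over a field with `w(R) ≠ 0`: **`(L(R)⁻¹)_{ij} = w_{ij}(R ∪ {j}) / w(R)`**
  (`inv_wLaplacian_submatrix_apply`) — the entries of the inverse of a principal submatrix of the
  weighted Laplacian are ratios of forest generating functions (the «one-off-principal» case of
  Chaiken's all-minors matrix-tree theorem).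

Definitions with bodies (`Leads`, `forestWeight`, `forestWeightTo`) and theorems; no named fact, no
instance, no notation. The Markov-chain readings (Green function, harmonic measure, mean first passage
times, Kemeny's constant) are the sequel files under `Probability/MarkovChains/`.

## References

* [PitmanTang2018] J. Pitman, W. Tang, Bernoulli 24 (2018), Thm. 1.2 (eqs. (1.4)–(1.6)), Lemma 2.2,
  proof of (1.9) (the matching (2.9)).
* [ChebotarevAgaev2002] P. Chebotarev, R. Agaev, LAA 356 (2002), §3 Thm. 2 (the principal-minor
  forest theorem, in the tree as `WeightedMatrixForestTheorem`).
* [Chaiken1982] S. Chaiken, SIAM J. Alg. Disc. Meth. 3 (1982) (all-minors matrix-tree theorem).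
* Tree: `Combinatorics/Enumerative/CayleyForests` (`IsForestOn`, `forests`),
  `Combinatorics/SimpleGraph/WeightedMatrixForestTheorem` (`wLaplacian`, `det_wLaplacian_submatrix`).
-/

namespace Literature.Combinatorics.Enumerative

open Finset Function Matrix Literature.Combinatorics.SimpleGraph.WeightedMatrixForest

variable {V : Type*}

/-! ### §1 Paths in a functional graph and surgery on rooted forests -/

section Leads

/-- `i` leads to `j` under iteration of the parent map `τ` («`i ⤳ j`»: the path from `i` towards the
roots passes through `j`). [cite: PitmanTang2018, Thm. 1.2 eq. (1.6) («in which the tree component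
containing `i` has root `j`»)] -/
def Leads (τ : V → V) (i j : V) : Prop := ∃ n : ℕ, τ^[n] i = j

variable {τ : V → V} {i j k x y : V}

/-- The trivial path. [cite: LyonsPeres2016, §4.1 (spanning arborescences: «there is no cycle, and … every vertex other than the root is the tail of exactly one edge in the tree … the edges in a spanning tree point toward its root»)] -/
theorem Leads.rfl : Leads τ i i := ⟨0, Eq.refl i⟩

/-- One arc. [cite: LyonsPeres2016, §4.1 (spanning arborescences: «there is no cycle, and … every vertex other than the root is the tail of exactly one edge in the tree … the edges in a spanning tree point toward its root»)] -/
theorem leads_apply (τ : V → V) (i : V) : Leads τ i (τ i) := ⟨1, rfl⟩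

/-- Concatenation of paths. [cite: LyonsPeres2016, §4.1 (spanning arborescences: «there is no cycle, and … every vertex other than the root is the tail of exactly one edge in the tree … the edges in a spanning tree point toward its root»)] -/
theorem Leads.trans (h₁ : Leads τ i j) (h₂ : Leads τ j k) : Leads τ i k := by
  obtain ⟨m, hm⟩ := h₁
  obtain ⟨n, hn⟩ := h₂
  exact ⟨n + m, by rw [iterate_add_apply, hm, hn]⟩

/-- Prepending the arc out of the origin. [cite: LyonsPeres2016, §4.1 (spanning arborescences: «there is no cycle, and … every vertex other than the root is the tail of exactly one edge in the tree … the edges in a spanning tree point toward its root»)] -/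
theorem Leads.of_apply (h : Leads τ (τ i) j) : Leads τ i j := (leads_apply τ i).trans h

/-- A path either is trivial or starts with the arc out of its origin. [cite: LyonsPeres2016, §4.1 (spanning arborescences: «there is no cycle, and … every vertex other than the root is the tail of exactly one edge in the tree … the edges in a spanning tree point toward its root»)] -/
theorem leads_iff_eq_or_leads_apply : Leads τ i j ↔ i = j ∨ Leads τ (τ i) j := by
  constructor
  · rintro ⟨n, hn⟩
    cases n with
    | zero => exact Or.inl hn
    | succ n => exact Or.inr ⟨n, by rwa [iterate_succ_apply] at hn⟩
  · rintro (rfl | h)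
    exacts [Leads.rfl, h.of_apply]

/-- A fixed point (a root) leads only to itself. [cite: LyonsPeres2016, §4.1 (spanning arborescences: «there is no cycle, and … every vertex other than the root is the tail of exactly one edge in the tree … the edges in a spanning tree point toward its root»)] -/
theorem leads_iff_of_apply_eq_self (h : τ i = i) : Leads τ i j ↔ j = i := by
  constructor
  · rintro ⟨n, hn⟩
    rw [iterate_fixed h] at hn
    exact hn.symm
  · rintro rfl
    exact Leads.rfl

/-- Two vertices on the path from `i` are comparable along it (out-degree one: the path is unique). [cite: LyonsPeres2016, §4.1 (spanning arborescences: «there is no cycle, and … every vertex other than the root is the tail of exactly one edge in the tree … the edges in a spanning tree point toward its root»)] -/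
theorem Leads.leads_or_leads (h₁ : Leads τ i j) (h₂ : Leads τ i k) : Leads τ j k ∨ Leads τ k j := by
  obtain ⟨m, hm⟩ := h₁
  obtain ⟨n, hn⟩ := h₂
  rcases le_total m n with hmn | hnm
  · left
    obtain ⟨d, rfl⟩ := Nat.exists_eq_add_of_le hmn
    refine ⟨d, ?_⟩
    rw [← hm, ← iterate_add_apply, add_comm]
    exact hn
  · right
    obtain ⟨d, rfl⟩ := Nat.exists_eq_add_of_le hnm
    refine ⟨d, ?_⟩
    rw [← hn, ← iterate_add_apply, add_comm]
    exact hm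

/-- The first passage of the path through `x`. [cite: LyonsPeres2016, §4.1 (spanning arborescences: «there is no cycle, and … every vertex other than the root is the tail of exactly one edge in the tree … the edges in a spanning tree point toward its root»)] -/
theorem Leads.exists_first (h : Leads τ i x) : ∃ n : ℕ, τ^[n] i = x ∧ ∀ m < n, τ^[m] i ≠ x := by
  classical
  exact ⟨Nat.find h, Nat.find_spec h, fun m hm => Nat.find_min h hm⟩

/-- If `i` does not lead to `x`, then neither does its parent. [cite: LyonsPeres2016, §4.1 (spanning arborescences: «there is no cycle, and … every vertex other than the root is the tail of exactly one edge in the tree … the edges in a spanning tree point toward its root»)] -/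
theorem not_leads_apply_of_not_leads (h : ¬ Leads τ i x) : ¬ Leads τ (τ i) x :=
  fun h' => h h'.of_apply

variable [DecidableEq V]

/-- Redirecting the arc out of `x` does not change a path before it meets `x`. [cite: PitmanTang2018,
§2, proof of (1.9) («Create **f′** by deleting this edge and replacing it with `i → j`»)] -/
theorem iterate_update_of_forall_ne {n : ℕ} (h : ∀ m < n, τ^[m] i ≠ x) :
    (update τ x y)^[n] i = τ^[n] i := by
  induction n with
  | zero => rfl
  | succ n ih =>
    rw [iterate_succ_apply', iterate_succ_apply', ih fun m hm => h m (hm.trans n.lt_succ_self),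
      update_of_ne (h n n.lt_succ_self)]

/-- A path avoiding `x` is unchanged when the arc out of `x` is redirected. [cite: PitmanTang2018,
§2, proof of (1.9)] -/
theorem leads_update_iff_of_not_leads (h : ¬ Leads τ i x) : Leads (update τ x y) i j ↔ Leads τ i j := by
  have key : ∀ n : ℕ, (update τ x y)^[n] i = τ^[n] i := fun n =>
    iterate_update_of_forall_ne fun m _ hm => h ⟨m, hm⟩
  simp only [Leads, key]

/-- A path through `x` still reaches `x` after the arc out of `x` is redirected.
[cite: PitmanTang2018, §2, proof of (1.9)] -/
theorem leads_update_of_leads (h : Leads τ i x) : Leads (update τ x y) i x := by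
  obtain ⟨n, hn, hlt⟩ := h.exists_first
  exact ⟨n, by rw [iterate_update_of_forall_ne hlt, hn]⟩

end Leads

/-! ### Rooted forests on all of `V` with root set `R`: the path calculus -/

section Forest

variable [Fintype V] [DecidableEq V] {R : Finset V} {τ : V → V} {i j k r v x y : V}

/-- `IsForestOn univ R τ` unpacked: `τ` fixes the roots and every vertex reaches a root.
[cite: PitmanTang2018, §1 («forests **f** labeled by `S` whose set of roots is `R`»)] -/
theorem isForestOn_univ_iff :
    IsForestOn (univ : Finset V) R τ ↔ (∀ v ∈ R, τ v = v) ∧ ∀ v, ∃ n : ℕ, τ^[n] v ∈ R := by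
  constructor
  · rintro ⟨h1, h2⟩
    exact ⟨fun v hv => h1 v (by simp [hv]), fun v => h2 v (mem_univ v)⟩
  · rintro ⟨h1, h2⟩
    refine ⟨fun v hv => h1 v ?_, fun v _ => h2 v⟩
    simpa using hv

omit [Fintype V] [DecidableEq V] in
/-- A non-root leading to a root still does so after its first arc. [cite: LyonsPeres2016, §4.1 (spanning arborescences: «there is no cycle, and … every vertex other than the root is the tail of exactly one edge in the tree … the edges in a spanning tree point toward its root»)] -/
theorem leads_apply_of_leads (hi : i ∉ R) (hr : r ∈ R) (hir : Leads τ i r) : Leads τ (τ i) r :=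
  (leads_iff_eq_or_leads_apply.1 hir).resolve_left fun h' => hi (h' ▸ hr)

namespace IsForestOn

/-- Roots stay put under iteration. [cite: PitmanTang2018, §1 («Each forest **f** with vertex set `S` and edges directed towards root vertices consists of some number `r` of trees **t**_i whose vertex sets partition `S`»)] -/
theorem iterate_root (h : IsForestOn (univ : Finset V) R τ) (hv : v ∈ R) (n : ℕ) : τ^[n] v = v :=
  iterate_fixed (h.apply_of_mem_roots hv) n

/-- Every vertex reaches a root. [cite: PitmanTang2018, §1 («Each forest **f** with vertex set `S` and edges directed towards root vertices consists of some number `r` of trees **t**_i whose vertex sets partition `S`»)] -/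
theorem exists_iterate_mem_roots (h : IsForestOn (univ : Finset V) R τ) (v : V) :
    ∃ n : ℕ, τ^[n] v ∈ R :=
  (isForestOn_univ_iff.1 h).2 v

/-- Once at a root the walk stays there. [cite: PitmanTang2018, §1 («Each forest **f** with vertex set `S` and edges directed towards root vertices consists of some number `r` of trees **t**_i whose vertex sets partition `S`»)] -/
theorem iterate_eq_of_le (h : IsForestOn (univ : Finset V) R τ) {n m : ℕ} (hn : τ^[n] v ∈ R)
    (hnm : n ≤ m) : τ^[m] v = τ^[n] v := by
  obtain ⟨d, rfl⟩ := Nat.exists_eq_add_of_le hnm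
  rw [add_comm, iterate_add_apply, h.iterate_root hn]

/-- A root leads only to itself. [cite: PitmanTang2018, §1 («Each forest **f** with vertex set `S` and edges directed towards root vertices consists of some number `r` of trees **t**_i whose vertex sets partition `S`»)] -/
theorem leads_root_iff (h : IsForestOn (univ : Finset V) R τ) (hi : i ∈ R) : Leads τ i j ↔ j = i :=
  leads_iff_of_apply_eq_self (h.apply_of_mem_roots hi)

/-- Every vertex leads to some root … [cite: PitmanTang2018, §1 («the tree component containing `i`
has root `j`»)] -/
theorem exists_leads_root (h : IsForestOn (univ : Finset V) R τ) (i : V) : ∃ r ∈ R, Leads τ i r := by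
  obtain ⟨n, hn⟩ := h.exists_iterate_mem_roots i
  exact ⟨_, hn, n, rfl⟩

/-- … and to only one. [cite: PitmanTang2018, §1 («the tree component containing `i` has root `j`»)] -/
theorem root_unique (h : IsForestOn (univ : Finset V) R τ) (hj : j ∈ R) (hk : k ∈ R)
    (h₁ : Leads τ i j) (h₂ : Leads τ i k) : j = k := by
  rcases h₁.leads_or_leads h₂ with h' | h'
  · exact ((h.leads_root_iff hj).1 h').symm
  · exact (h.leads_root_iff hk).1 h'

/-- A non-root moves (it is the tail of an arc). [cite: LyonsPeres2016, §4.1 (spanning arborescences: «there is no cycle, and … every vertex other than the root is the tail of exactly one edge in the tree … the edges in a spanning tree point toward its root»)] -/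
theorem apply_ne_self (h : IsForestOn (univ : Finset V) R τ) (hv : v ∉ R) : τ v ≠ v := by
  intro heq
  obtain ⟨n, hn⟩ := h.exists_iterate_mem_roots v
  rw [iterate_fixed heq] at hn
  exact hv hn

/-- No return: the path from the parent of a non-root `v` never comes back to `v` («there is no
cycle»). [cite: LyonsPeres2016, §4.1 (spanning arborescences: «there is no cycle, and … every vertex other than the root is the tail of exactly one edge in the tree … the edges in a spanning tree point toward its root»)] -/
theorem not_leads_apply_self (h : IsForestOn (univ : Finset V) R τ) (hv : v ∉ R) : ¬ Leads τ (τ v) v := by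
  rintro ⟨n, hn⟩
  rw [← iterate_succ_apply] at hn
  obtain ⟨N, hN⟩ := h.exists_iterate_mem_roots v
  have hper : ∀ m : ℕ, τ^[m * (n + 1)] v = v := by
    intro m
    induction m with
    | zero => simp
    | succ m ih => rw [Nat.succ_mul, iterate_add_apply, hn, ih]
  have key := h.iterate_eq_of_le hN (Nat.le_mul_of_pos_right N (Nat.succ_pos n))
  rw [hper] at key
  rw [← key] at hN
  exact hv hN

/-- **Redirecting an arc.** If the path from `y` avoids `x`, replacing the arc out of `x` by `x → y`
gives a forest with root set `R ∖ {x}` (for a root `x`: its tree is attached below `y`; for a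
non-root `x` the root set is unchanged). [cite: PitmanTang2018, §2, proof of Lemma 2.2 («that subtree
is attached to the remaining forest **f** at vertex `k`»); proof of (1.9) («Create **f′** by deleting
this edge and replacing it with `i → j`»)] -/
theorem update_erase (h : IsForestOn (univ : Finset V) R τ) (hy : ¬ Leads τ y x) :
    IsForestOn (univ : Finset V) (R.erase x) (update τ x y) := by
  have h' := isForestOn_univ_iff.1 h
  rw [isForestOn_univ_iff]
  refine ⟨fun v hv => ?_, fun v => ?_⟩
  · rw [update_of_ne (ne_of_mem_erase hv)]
    exact h'.1 v (mem_of_mem_erase hv)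
  · -- the old root of `y` is not `x`
    obtain ⟨n, hn⟩ := h'.2 y
    have hnx : τ^[n] y ≠ x := fun heq => hy ⟨n, heq⟩
    by_cases hv : Leads τ v x
    · -- go to `x`, step to `y`, then follow the old path of `y`
      obtain ⟨m, hm⟩ := leads_update_of_leads (y := y) hv
      refine ⟨n + (m + 1), ?_⟩
      rw [iterate_add_apply, iterate_succ_apply', hm, update_self,
        iterate_update_of_forall_ne fun p _ hp => hy ⟨p, hp⟩]
      exact mem_erase.2 ⟨hnx, hn⟩
    · obtain ⟨p, hp⟩ := h'.2 v
      refine ⟨p, ?_⟩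
      rw [iterate_update_of_forall_ne fun q _ hq => hv ⟨q, hq⟩]
      exact mem_erase.2 ⟨fun heq => hv ⟨p, heq⟩, hp⟩

/-- **Redirecting a non-root**: for `x ∉ R` the root set stays `R`. [cite: PitmanTang2018, §2, proof
of (1.9) («Then it is easily seen that `(k, f′)` is as required»)] -/
theorem update_of_not_leads (h : IsForestOn (univ : Finset V) R τ) (hx : x ∉ R) (hy : ¬ Leads τ y x) :
    IsForestOn (univ : Finset V) R (update τ x y) := by
  have h' := h.update_erase hy
  rwa [Finset.erase_eq_self.2 hx] at h'

/-- **Cutting above `x`.** Declaring `x` a root (arc out of `x` deleted) gives a forest with root set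
`R ∪ {x}`. [cite: PitmanTang2018, §2, proof of Lemma 2.2 (the fringe subtree rooted at `j`)] -/
theorem update_self_insert (h : IsForestOn (univ : Finset V) R τ) (x : V) :
    IsForestOn (univ : Finset V) (insert x R) (update τ x x) := by
  have h' := isForestOn_univ_iff.1 h
  rw [isForestOn_univ_iff]
  refine ⟨fun v hv => ?_, fun v => ?_⟩
  · rcases mem_insert.1 hv with rfl | hv
    · exact update_self _ _ _
    · by_cases hvx : v = x
      · subst hvx
        exact update_self _ _ _
      · rw [update_of_ne hvx]
        exact h'.1 v hv
  · by_cases hv : Leads τ v x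
    · obtain ⟨m, hm⟩ := leads_update_of_leads (y := x) hv
      exact ⟨m, by rw [hm]; exact mem_insert_self x R⟩
    · obtain ⟨p, hp⟩ := h'.2 v
      exact ⟨p, by
        rw [iterate_update_of_forall_ne fun q _ hq => hv ⟨q, hq⟩]
        exact mem_insert_of_mem hp⟩

end IsForestOn

omit [Fintype V] in
/-- The weight of a forest after redirecting the arc out of `x ∈ T`: the factor `a x (τ x)` is
replaced by `a x y`. [cite: PitmanTang2018, §2, proof of (1.9) (eq. (2.8): `p_{ij} Π(f) = p_{ik} Π(f′)`)] -/
theorem prod_update_eq {S : Type*} [CommMonoid S] (a : V → V → S) {T : Finset V} (hx : x ∈ T) :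
    ∏ v ∈ T, a v (update τ x y v) = a x y * ∏ v ∈ T.erase x, a v (τ v) := by
  rw [← mul_prod_erase T _ hx, update_self]
  congr 1
  exact prod_congr rfl fun v hv => by rw [update_of_ne (ne_of_mem_erase hv)]

end Forest

/-! ### §2 Forest weights `w(R)` and `w_{ij}(R)` -/

section Weights

variable [Fintype V] [DecidableEq V] {S : Type*} [CommRing S]

/-- **`w(R) = Σ_{roots(f) = R} Π(f)`**, the total weight of the forests with root set `R`, the weight
of a forest being the product `∏_{v ∉ R} a v (τ v)` of its arc weights. [cite: PitmanTang2018,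
Thm. 1.2 eq. (1.4)] -/
noncomputable def forestWeight (a : V → V → S) (R : Finset V) : S :=
  ∑ τ ∈ forests (univ : Finset V) R, ∏ v ∈ Rᶜ, a v (τ v)

open Classical in
/-- **`w_{ij}(R) = Σ_{roots(f) = R, i ⤳ j} Π(f)`**, the total weight of the forests with root set `R` in
which `i` leads to `j` (for `j ∈ R`: in which the tree containing `i` has root `j`).
[cite: PitmanTang2018, Thm. 1.2 eq. (1.6); eq. (1.9) (`w_{ij}(R)`)] -/
noncomputable def forestWeightTo (a : V → V → S) (R : Finset V) (i j : V) : S :=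
  ∑ τ ∈ (forests (univ : Finset V) R).filter (fun τ => Leads τ i j), ∏ v ∈ Rᶜ, a v (τ v)

variable (a : V → V → S) (R : Finset V)

/-- [cite: PitmanTang2018, Thm. 1.2 eq. (1.4)] -/
theorem forestWeight_def : forestWeight a R = ∑ τ ∈ forests (univ : Finset V) R, ∏ v ∈ Rᶜ, a v (τ v) :=
  rfl

open Classical in
/-- [cite: PitmanTang2018, Thm. 1.2 eq. (1.6)] -/
theorem forestWeightTo_def (i j : V) : forestWeightTo a R i j =
    ∑ τ ∈ (forests (univ : Finset V) R).filter (fun τ => Leads τ i j), ∏ v ∈ Rᶜ, a v (τ v) :=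
  rfl

open Classical in
/-- `w_{ij}(R)` as a sum with an indicator. [cite: PitmanTang2018, Thm. 1.2 eq. (1.6)] -/
theorem forestWeightTo_eq_sum_ite (i j : V) : forestWeightTo a R i j =
    ∑ τ ∈ forests (univ : Finset V) R, if Leads τ i j then ∏ v ∈ Rᶜ, a v (τ v) else 0 := by
  rw [forestWeightTo_def, sum_filter]

/-- With every vertex a root there is one forest (no arcs), of weight `1`: `w(S) = 1`.
[cite: PitmanTang2018, §2, proof of Cor. 2.3 («the enumerations `c(n,n) = 1` … are obvious»)] -/
theorem forestWeight_univ : forestWeight a (univ : Finset V) = 1 := by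
  rw [forestWeight, forests_self, sum_singleton, Finset.compl_univ, prod_empty]

/-- Without roots there is no forest on a nonempty vertex set: `w(∅) = 0`. [cite: PitmanTang2018,
Lemma 2.1 («For `R` a non-empty subset of `S`»)] -/
theorem forestWeight_empty [Nonempty V] : forestWeight a (∅ : Finset V) = 0 := by
  rw [forestWeight, forests_empty univ_nonempty, sum_empty]

/-- For a ROOT `i`: `w_{ij}(R) = [j = i] · w(R)` (a root leads only to itself).
[cite: PitmanTang2018, eq. (1.9) («where `w_{ij}(R) = w_{ij}(R ∪ {j})` … but now `j ∈ R`»)] -/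
theorem forestWeightTo_of_mem_roots {i : V} (hi : i ∈ R) (j : V) :
    forestWeightTo a R i j = if j = i then forestWeight a R else 0 := by
  rw [forestWeightTo_eq_sum_ite, forestWeight]
  split_ifs with hji
  · refine sum_congr rfl fun τ hτ => ?_
    rw [if_pos (((mem_forests.1 hτ).leads_root_iff hi).2 hji)]
  · refine sum_eq_zero fun τ hτ => ?_
    rw [if_neg fun h' => hji (((mem_forests.1 hτ).leads_root_iff hi).1 h')]

/-- `w_{ii}(R) = w(R)`. [cite: PitmanTang2018, §2, proof of Lemma 2.2 (the term `k = j`)] -/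
theorem forestWeightTo_self (i : V) : forestWeightTo a R i i = forestWeight a R := by
  rw [forestWeightTo_eq_sum_ite, forestWeight]
  exact sum_congr rfl fun τ _ => if_pos Leads.rfl

/-- **Every vertex lies in exactly one tree**: `Σ_{r ∈ R} w_{ir}(R) = w(R)`. [cite: PitmanTang2018,
§1 («whose vertex sets partition `S`»)] -/
theorem sum_forestWeightTo (i : V) : ∑ r ∈ R, forestWeightTo a R i r = forestWeight a R := by
  classical
  simp_rw [forestWeightTo_eq_sum_ite]
  rw [sum_comm, forestWeight]
  refine sum_congr rfl fun τ hτ => ?_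
  have h := mem_forests.1 hτ
  obtain ⟨r₀, hr₀, hir₀⟩ := h.exists_leads_root i
  rw [← sum_filter]
  have hfilt : R.filter (fun r => Leads τ i r) = {r₀} := by
    ext r
    simp only [mem_filter, mem_singleton]
    constructor
    · rintro ⟨hr, hir⟩
      exact h.root_unique hr hr₀ hir hir₀
    · rintro rfl
      exact ⟨hr₀, hir₀⟩
  rw [hfilt, sum_singleton]

/-- **`det L(R) = w(R)`** — the principal minor of the weighted Laplacian on the rows and columns off
`R` is the weight of the forests rooted at `R` (the tree's weighted matrix-forest theorem, restated
with the root set as parameter). [cite: PitmanTang2018, Thm. 1.2 eq. (1.4); Thm. 4.1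
(Kirchhoff–Chaiken–Chen)] [cite: ChebotarevAgaev2002, §3 Thm. 2] -/
theorem det_wLaplacian_submatrix_eq_forestWeight :
    ((wLaplacian a).submatrix (Subtype.val : ↥(Rᶜ) → V) Subtype.val).det = forestWeight a R := by
  rw [det_wLaplacian_submatrix, compl_compl, forestWeight]

end Weights

/-! ### §3 The two arc-exchange identities: Lemma 2.2 and the harmonic identity (2.9) -/

section Exchange

variable [Fintype V] [DecidableEq V] {S : Type*} [CommRing S] (a : V → V → S) {R : Finset V}

open Classical in
/-- **Lemma 2.2, division-free, arbitrary weights**: for `j ∉ R`,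
`(Σ_{k ≠ j} a_{jk}) · w(R ∪ {j}) = w(R) + Σ_{k ∉ R ∪ {j}} a_{jk} · w_{kj}(R ∪ {j})`.
A forest **f** rooted at `R ∪ {j}` together with an arc `j → k`: if `k` is not in the tree of `j`,
attaching that tree below `k` gives a forest rooted at `R` (every one exactly once: delete the arc out
of `j`); if `k ⤳ j`, the pair is counted by `w_{kj}(R ∪ {j})`. [cite: PitmanTang2018, Lemma 2.2
(and its proof)] -/
theorem outWeight_mul_forestWeight_insert {j : V} (hj : j ∉ R) :
    (∑ k ∈ univ.erase j, a j k) * forestWeight a (insert j R) =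
      forestWeight a R + ∑ k ∈ (insert j R)ᶜ, a j k * forestWeightTo a (insert j R) k j := by
  have hjR' : j ∈ insert j R := mem_insert_self j R
  have hRj : Rᶜ.erase j = (insert j R)ᶜ := Finset.compl_insert.symm
  have hjRc : j ∈ Rᶜ := mem_compl.2 hj
  -- expand the left-hand side and split every inner sum according to `k ⤳ j`
  rw [forestWeight, sum_mul_sum]
  have hsplit : ∀ k ∈ univ.erase j,
      ∑ τ ∈ forests univ (insert j R), a j k * ∏ v ∈ (insert j R)ᶜ, a v (τ v) =
        (∑ τ ∈ (forests univ (insert j R)).filter (fun τ => ¬ Leads τ k j),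
            a j k * ∏ v ∈ (insert j R)ᶜ, a v (τ v)) +
          ∑ τ ∈ (forests univ (insert j R)).filter (fun τ => Leads τ k j),
            a j k * ∏ v ∈ (insert j R)ᶜ, a v (τ v) := by
    intro k _
    rw [add_comm, sum_filter_add_sum_filter_not]
  rw [sum_congr rfl hsplit, sum_add_distrib]
  congr 1
  · -- first part: for each `k`, `f ↦ f[j ↦ k]` is a bijection onto the forests `f'` rooted at `R`
    -- with `f'(j) = k` (inverse: delete the arc out of `j`)
    rw [forestWeight, ← sum_fiberwise_of_maps_to (s := forests univ R) (t := univ.erase j)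
      (g := fun τ : V → V => τ j)
      (fun τ hτ => mem_erase.2 ⟨(mem_forests.1 hτ).apply_ne_self hj, mem_univ _⟩)]
    refine sum_congr rfl fun k _ => ?_
    refine sum_nbij' (fun τ => update τ j k) (fun τ => update τ j j) ?_ ?_ ?_ ?_ ?_
    · intro τ hτ
      simp only [mem_filter, mem_forests] at hτ ⊢
      obtain ⟨hτ, hkj⟩ := hτ
      have h := hτ.update_erase hkj
      rw [erase_insert hj] at h
      exact ⟨h, update_self _ _ _⟩
    · intro τ hτ
      simp only [mem_filter, mem_forests] at hτ ⊢
      obtain ⟨hτ, hτj⟩ := hτ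
      refine ⟨hτ.update_self_insert j, ?_⟩
      rw [← hτj, leads_update_iff_of_not_leads (hτ.not_leads_apply_self hj)]
      exact hτ.not_leads_apply_self hj
    · intro τ hτ
      simp only [mem_filter, mem_forests] at hτ
      rw [update_idem]
      exact update_eq_iff.2 ⟨(hτ.1.apply_of_mem_roots hjR').symm, fun _ _ => rfl⟩
    · intro τ hτ
      simp only [mem_filter, mem_forests] at hτ
      rw [update_idem]
      exact update_eq_iff.2 ⟨hτ.2.symm, fun _ _ => rfl⟩
    · intro τ _
      rw [prod_update_eq a hjRc, hRj]
  · -- second part: `k ⤳ j` forces `k ∉ R ∪ {j}` for a non-zero contribution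
    have hvan : ∀ k ∈ univ.erase j, k ∉ (insert j R)ᶜ →
        a j k * forestWeightTo a (insert j R) k j = 0 := by
      intro k hk hkc
      have hkR' : k ∈ insert j R := by
        rw [mem_compl, not_not] at hkc
        exact hkc
      rw [forestWeightTo_of_mem_roots a (insert j R) hkR', if_neg (ne_of_mem_erase hk).symm, mul_zero]
    rw [sum_subset (fun k hk => mem_erase.2 ⟨fun h => (mem_compl.1 hk) (h ▸ hjR'), mem_univ k⟩) hvan]
    refine sum_congr rfl fun k _ => ?_
    rw [forestWeightTo_def, mul_sum]

/-- **Lemma 2.2 as printed** (unit row sums, diagonal entries allowed): for `j ∉ R`,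
`w(R ∪ {j}) = w(R) + Σ_{k ∉ R} a_{jk} w_{kj}(R ∪ {j})` (the term `k = j` being `a_{jj} w(R ∪ {j})`).
[cite: PitmanTang2018, Lemma 2.2] -/
theorem forestWeight_insert_of_rowsum {j : V} (hj : j ∉ R) (hrow : ∑ k, a j k = 1) :
    forestWeight a (insert j R) =
      forestWeight a R + ∑ k ∈ Rᶜ, a j k * forestWeightTo a (insert j R) k j := by
  have h := outWeight_mul_forestWeight_insert a hj
  have hrow' : ∑ k ∈ univ.erase j, a j k = 1 - a j j := by
    rw [← hrow, ← add_sum_erase _ _ (mem_univ j)]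
    ring
  have hRc : Rᶜ = insert j (insert j R)ᶜ := by
    rw [Finset.compl_insert, insert_erase (mem_compl.2 hj)]
  rw [hRc, sum_insert (by simp), forestWeightTo_self]
  rw [hrow'] at h
  linear_combination h

open Classical in
/-- **The harmonic identity (2.9), arbitrary weights**: for `i ∉ R` and a root `r ∈ R`,
`(Σ_{k ≠ i} a_{ik}) · w_{ir}(R) = Σ_{k ≠ i} a_{ik} · w_{kr}(R)`.
Both sides count pairs (arc `i → k`, forest **f**); the pairs with both `i ⤳ r` and `k ⤳ r` appear
on both sides, and the exchange `(k, f) ↦ (f(i), f[i ↦ k])` («let `i → k` be the edge out of `i` in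
**f**; create **f′** by deleting this edge and replacing it with `i → j`») matches the rest.
[cite: PitmanTang2018, §2, proof of the harmonic tree formula (1.9), eqs. (2.8)–(2.9)] -/
theorem outWeight_mul_forestWeightTo {i r : V} (hi : i ∉ R) (hr : r ∈ R) :
    (∑ k ∈ univ.erase i, a i k) * forestWeightTo a R i r =
      ∑ k ∈ univ.erase i, a i k * forestWeightTo a R k r := by
  have hir : i ≠ r := fun h => hi (h ▸ hr)
  have hiRc : i ∈ Rᶜ := mem_compl.2 hi
  set F := forests (univ : Finset V) R with hF
  set w : (V → V) → S := fun τ => ∏ v ∈ Rᶜ, a v (τ v) with hw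
  -- both sides as double sums, each inner sum split by the other side's condition
  have hL : (∑ k ∈ univ.erase i, a i k) * forestWeightTo a R i r =
      (∑ k ∈ univ.erase i, ∑ τ ∈ F.filter (fun τ => Leads τ i r ∧ Leads τ k r), a i k * w τ) +
        ∑ k ∈ univ.erase i, ∑ τ ∈ F.filter (fun τ => Leads τ i r ∧ ¬ Leads τ k r), a i k * w τ := by
    rw [forestWeightTo_def, sum_mul, ← sum_add_distrib]
    refine sum_congr rfl fun k _ => ?_
    rw [mul_sum, ← sum_filter_add_sum_filter_not (F.filter fun τ => Leads τ i r) (fun τ => Leads τ k r),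
      filter_filter, filter_filter]
  have hR : ∑ k ∈ univ.erase i, a i k * forestWeightTo a R k r =
      (∑ k ∈ univ.erase i, ∑ τ ∈ F.filter (fun τ => Leads τ i r ∧ Leads τ k r), a i k * w τ) +
        ∑ k ∈ univ.erase i, ∑ τ ∈ F.filter (fun τ => Leads τ k r ∧ ¬ Leads τ i r), a i k * w τ := by
    rw [← sum_add_distrib]
    refine sum_congr rfl fun k _ => ?_
    rw [forestWeightTo_def, mul_sum,
      ← sum_filter_add_sum_filter_not (F.filter fun τ => Leads τ k r) (fun τ => Leads τ i r),
      filter_filter, filter_filter]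
    congr 2
    ext τ
    simp only [mem_filter]
    tauto
  rw [hL, hR]
  congr 1
  -- the remaining pairs (arc `i → k`, forest), as finsets of pairs
  set X := ((univ.erase i) ×ˢ F).filter
    (fun q : V × (V → V) => Leads q.2 i r ∧ ¬ Leads q.2 q.1 r) with hX
  set Y := ((univ.erase i) ×ˢ F).filter
    (fun q : V × (V → V) => Leads q.2 q.1 r ∧ ¬ Leads q.2 i r) with hY
  have hXm : ∀ q : V × (V → V), q ∈ X ↔
      q.1 ∈ univ.erase i ∧ q.2 ∈ F.filter (fun τ => Leads τ i r ∧ ¬ Leads τ q.1 r) := by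
    intro q
    simp only [hX, mem_filter, mem_product, and_assoc]
  have hYm : ∀ q : V × (V → V), q ∈ Y ↔
      q.1 ∈ univ.erase i ∧ q.2 ∈ F.filter (fun τ => Leads τ q.1 r ∧ ¬ Leads τ i r) := by
    intro q
    simp only [hY, mem_filter, mem_product, and_assoc]
  rw [show (∑ k ∈ univ.erase i, ∑ τ ∈ F.filter (fun τ => Leads τ i r ∧ ¬ Leads τ k r), a i k * w τ)
        = ∑ q ∈ X, a i q.1 * w q.2 from
      (sum_finset_product' (f := fun k τ => a i k * w τ) X (univ.erase i)
        (fun k => F.filter fun τ => Leads τ i r ∧ ¬ Leads τ k r) hXm).symm,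
    show (∑ k ∈ univ.erase i, ∑ τ ∈ F.filter (fun τ => Leads τ k r ∧ ¬ Leads τ i r), a i k * w τ)
        = ∑ q ∈ Y, a i q.1 * w q.2 from
      (sum_finset_product' (f := fun k τ => a i k * w τ) Y (univ.erase i)
        (fun k => F.filter fun τ => Leads τ k r ∧ ¬ Leads τ i r) hYm).symm]
  -- the exchange `(k, f) ↦ (f(i), f[i ↦ k])`, an involution of the same shape in both directions
  refine sum_nbij' (fun q => (q.2 i, update q.2 i q.1)) (fun q => (q.2 i, update q.2 i q.1))
    ?_ ?_ ?_ ?_ ?_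
  · rintro ⟨k, τ⟩ hq
    rw [hXm] at hq
    rw [hYm]
    simp only [mem_filter, mem_erase, mem_univ, and_true, hF, mem_forests] at hq ⊢
    obtain ⟨hki, hτ, hirτ, hkr⟩ := hq
    have hki' : ¬ Leads τ k i := fun h' => hkr (h'.trans hirτ)
    have hτi : ¬ Leads τ (τ i) i := hτ.not_leads_apply_self hi
    refine ⟨hτ.apply_ne_self hi, hτ.update_of_not_leads hi hki', ?_, ?_⟩
    · rw [leads_update_iff_of_not_leads hτi]
      exact leads_apply_of_leads hi hr hirτ
    · intro h'
      rcases leads_iff_eq_or_leads_apply.1 h' with h'' | h''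
      · exact hir h''
      · rw [update_self, leads_update_iff_of_not_leads hki'] at h''
        exact hkr h''
  · rintro ⟨m, τ⟩ hq
    rw [hYm] at hq
    rw [hXm]
    simp only [mem_filter, mem_erase, mem_univ, and_true, hF, mem_forests] at hq ⊢
    obtain ⟨hmi, hτ, hmr, hirτ⟩ := hq
    have hmi' : ¬ Leads τ m i := by
      intro h'
      rcases h'.leads_or_leads hmr with h₁ | h₁
      · exact hirτ h₁
      · exact hir ((hτ.leads_root_iff hr).1 h₁)
    have hτi : ¬ Leads τ (τ i) i := hτ.not_leads_apply_self hi
    refine ⟨hτ.apply_ne_self hi, hτ.update_of_not_leads hi hmi', ?_, ?_⟩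
    · rw [leads_iff_eq_or_leads_apply, update_self, leads_update_iff_of_not_leads hmi']
      exact Or.inr hmr
    · rw [leads_update_iff_of_not_leads hτi]
      exact fun h' => hirτ h'.of_apply
  · rintro ⟨k, τ⟩ _
    simp only [update_self, update_idem, update_eq_self]
  · rintro ⟨m, τ⟩ _
    simp only [update_self, update_idem, update_eq_self]
  · rintro ⟨k, τ⟩ _
    simp only [hw]
    rw [prod_update_eq a hiRc, ← mul_prod_erase Rᶜ (fun v => a v (τ v)) hiRc]
    ring

end Exchange

/-! ### §4 Theorem 1.2, second half: `L(R) · (w_{ij}(R ∪ {j})) = w(R) · I` and the inverse -/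

section Inverse

variable [Fintype V] [DecidableEq V] {S : Type*} [CommRing S] (a : V → V → S) (R : Finset V)

/-- **`L(R) · (w_{ij}(R ∪ {j}))_{i,j ∉ R} = w(R) · I`** for ARBITRARY arc weights — the diagonal
entries are Lemma 2.2, the off-diagonal ones the harmonic identity (2.9) with root set `R ∪ {j}`.
[cite: PitmanTang2018, Thm. 1.2 eq. (1.5) (cleared of the denominator `w(R)`); Lemma 2.2; eq. (2.9)] -/
theorem wLaplacian_submatrix_mul_forestWeightTo :
    (wLaplacian a).submatrix (Subtype.val : ↥(Rᶜ) → V) Subtype.val *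
        (Matrix.of fun i j : ↥(Rᶜ) => forestWeightTo a (insert (j : V) R) i j) =
      forestWeight a R • (1 : Matrix ↥(Rᶜ) ↥(Rᶜ) S) := by
  ext i j
  have hi : (i : V) ∉ R := mem_compl.1 i.2
  have hj : (j : V) ∉ R := mem_compl.1 j.2
  have hjR' : (j : V) ∈ insert (j : V) R := mem_insert_self _ R
  rw [Matrix.mul_apply, Matrix.smul_apply, smul_eq_mul]
  simp only [submatrix_apply, of_apply]
  rw [Finset.sum_coe_sort Rᶜ (fun k => wLaplacian a i k * forestWeightTo a (insert (j : V) R) k j),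
    ← add_sum_erase _ _ i.2, wLaplacian_apply_self]
  have hoff : ∑ k ∈ Rᶜ.erase i, wLaplacian a i k * forestWeightTo a (insert (j : V) R) k j =
      -∑ k ∈ Rᶜ.erase i, a i k * forestWeightTo a (insert (j : V) R) k j := by
    rw [← sum_neg_distrib]
    refine sum_congr rfl fun k hk => ?_
    rw [wLaplacian_apply_of_ne _ (ne_of_mem_erase hk).symm, neg_mul]
  rw [hoff]
  by_cases hij : i = j
  · subst hij
    rw [Matrix.one_apply_eq, mul_one, forestWeightTo_self, outWeight_mul_forestWeight_insert a hi,
      Finset.compl_insert]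
    ring
  · have hij' : (i : V) ≠ j := fun h => hij (Subtype.ext h)
    have hiR' : (i : V) ∉ insert (j : V) R := by simp [hij', hi]
    rw [Matrix.one_apply_ne hij, mul_zero, outWeight_mul_forestWeightTo a hiR' hjR']
    -- the roots `k ∈ R` (all `≠ j`) contribute nothing
    have hvan : ∀ k ∈ univ.erase (i : V), k ∉ Rᶜ.erase i →
        a i k * forestWeightTo a (insert (j : V) R) k j = 0 := by
      intro k hk hkc
      have hkR : k ∈ R := by
        by_contra hkR
        exact hkc (mem_erase.2 ⟨ne_of_mem_erase hk, mem_compl.2 hkR⟩)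
      rw [forestWeightTo_of_mem_roots a _ (mem_insert_of_mem hkR), if_neg (fun h : (j : V) = k => hj (h ▸ hkR)),
        mul_zero]
    rw [sum_subset (fun k hk => mem_erase.2 ⟨ne_of_mem_erase hk, mem_univ k⟩) hvan, add_neg_cancel]

/-- **Theorem 1.2, second half (the inverse of `L(R)`)**: over a field, if `w(R) ≠ 0` (equivalently
`det L(R) ≠ 0`) then `(L(R)⁻¹)_{ij} = w_{ij}(R ∪ {j}) / w(R)` for all `i, j ∉ R`.
[cite: PitmanTang2018, Thm. 1.2 eq. (1.5)] -/
theorem inv_wLaplacian_submatrix_apply {K : Type*} [Field K] (a : V → V → K) (R : Finset V)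
    (hR : forestWeight a R ≠ 0) (i j : ↥(Rᶜ)) :
    ((wLaplacian a).submatrix (Subtype.val : ↥(Rᶜ) → V) Subtype.val)⁻¹ i j =
      forestWeightTo a (insert (j : V) R) i j / forestWeight a R := by
  have h := wLaplacian_submatrix_mul_forestWeightTo a R
  have hinv : ((wLaplacian a).submatrix (Subtype.val : ↥(Rᶜ) → V) Subtype.val)⁻¹ =
      (forestWeight a R)⁻¹ •
        (Matrix.of fun i j : ↥(Rᶜ) => forestWeightTo a (insert (j : V) R) i j) :=
    Matrix.inv_eq_right_inv (by rw [Matrix.mul_smul, h, smul_smul, inv_mul_cancel₀ hR, one_smul])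
  rw [hinv, Matrix.smul_apply, of_apply, smul_eq_mul, div_eq_inv_mul]

/-- `det L(R) ≠ 0 ↔ w(R) ≠ 0`, the hypothesis of (1.5) in either language. [cite: PitmanTang2018,
Thm. 1.2 («if `det L(R) > 0`»); Lemma 2.1 ((1) ⟺ (5))] -/
theorem det_wLaplacian_submatrix_ne_zero_iff :
    ((wLaplacian a).submatrix (Subtype.val : ↥(Rᶜ) → V) Subtype.val).det ≠ 0 ↔
      forestWeight a R ≠ 0 := by
  rw [det_wLaplacian_submatrix_eq_forestWeight]

end Inverse

end Literature.Combinatorics.Enumerative
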